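import Literature.MathematicalPhysics.QuantumFieldTheory.YangMillsOS
import Literature.MathematicalPhysics.QuantumFieldTheory.UnevenAxialBlocking
import Literature.MathematicalPhysics.QuantumLattice.TorusWilsonFlowContinuity
import Literature.MathematicalPhysics.QuantumLattice.BalabanBlockAverage
import HarnessLib

/-!
# Crux `FemtoCurvatureTwoPointC` (stmt-QuantumFields-16204, route `LangevinControlUV`), line `conditional-covariance-floor`:
# the flowed-then-blocked conditioning field is measurable

Skeleton v2 of the line (lead a1, 2026-08-17) conditions Wilson's measure on the σ-algebra generated by the straight
coarse transporters (the tree's uneven axial blocking `unevenAxialLink b L T`, run over the matrix monoid) of the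
Wilson-FLOWED link matrices `wilsonFlowMatrix r.ρ t U` (Lüscher's gradient flow, JHEP 08 (2010) 071 (1.4), tree
`Literature/MathematicalPhysics/QuantumLattice/LatticeWilsonFlow`), replacing v1's conditioning on the decimated comb of the
bare field (audit: wave 1 of the line, workers Flo/Dec). The law of total covariance used by the skeleton glue
(`Literature.Probability.Moments.integral_residual_mul_add_covariance_condExp`) needs this σ-algebra to be a sub-σ-algebra of
the product σ-algebra of the configuration space, i.e. measurability of the flowed, blocked field — which is what this file
proves, for every faithful continuous unitary lattice representation `r`, every torus `L`, block data `b, T` and flow time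
`t`: `U ↦ ρ ∘ U` is continuous, the flow is continuous on unitary fields (`continuous_wilsonFlowMatrix`), a straight
transporter is a finite ordered product (`continuous_transport_config`), matrix entries are continuous, and a faithful
finite-dimensional representation makes `G` second countable, so continuity gives measurability. Registered sub-goal
`comap_flowDecimate_le` of crux stmt-QuantumFields-16204. Nothing else is here (no physics).
-/

set_option autoImplicit false

noncomputable section

open MeasureTheory
open Literature.MathematicalPhysics.QuantumFieldTheory

namespace Summit.QuantumFields.YangMills.Theorems.FemtoCurvatureTwoPointC

/-- **The flowed, blocked field is a measurable function of the fine configuration** (entrywise in `ℂ`): for a lattice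
representation `r` of a compact group `G`, a torus side `L`, block factor `b`, coarse side `T` and flow time `t`, the map
`U ↦ ((e, i, j) ↦ (unevenAxialLink b L T (wilsonFlowMatrix r.ρ t U) e) i j)` is measurable for the product σ-algebras.
[folklore] -/
theorem measurable_flowDecimate {G : Type} [Group G] [TopologicalSpace G] [CompactSpace G]
    [MeasurableSpace G] [BorelSpace G] (r : LatticeRep G) (b L T : ℕ) [NeZero L] (t : ℝ) :
    Measurable fun (U : GaugeConfig 4 L G) (e : Edge 4 T) (i j : Fin r.N) =>
      unevenAxialLink b L T (Literature.MathematicalPhysics.QuantumLattice.wilsonFlowMatrix r.ρ t U) e i j := by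
  haveI : SecondCountableTopology G :=
    (r.continuous.isClosedEmbedding r.injective).isEmbedding.secondCountableTopology
  refine measurable_pi_lambda _ fun e => measurable_pi_lambda _ fun i => measurable_pi_lambda _ fun j => ?_
  have h1 : Continuous fun U : GaugeConfig 4 L G =>
      Literature.MathematicalPhysics.QuantumLattice.wilsonFlowMatrix r.ρ t U :=
    Literature.MathematicalPhysics.QuantumLattice.continuous_wilsonFlowMatrix r.ρ r.continuous r.mem_unitary t
  have h2 : Continuous fun V : GaugeConfig 4 L (Matrix (Fin r.N) (Fin r.N) ℂ) => unevenAxialLink b L T V e :=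
    Literature.MathematicalPhysics.QuantumLattice.continuous_transport_config _ _
  exact ((h2.comp h1).matrix_elem i j).measurable

/-- **Registered sub-goal `comap_flowDecimate_le`** (line `conditional-covariance-floor`, skeleton v2): the conditioning
σ-algebra of the stubs `stub_flowedMeanFloor` / `stub_flowedDecoupling` — flow at time `t`, then uneven axial blocking with
data `b, L, T`, read entrywise — is a sub-σ-algebra of the product σ-algebra of `GaugeConfig 4 L G`, for every lattice
representation `r` of a compact group, so that Mathlib's conditional expectation given it is the genuine one. [folklore] -/
theorem comap_flowDecimate_le :
    ∀ {G : Type} [Group G] [TopologicalSpace G] [CompactSpace G] [MeasurableSpace G] [BorelSpace G]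
      (r : LatticeRep G) (b L T : ℕ) [NeZero L] (t : ℝ),
      MeasurableSpace.comap
          (fun (U : GaugeConfig 4 L G) (e : Edge 4 T) (i j : Fin r.N) =>
            unevenAxialLink b L T (Literature.MathematicalPhysics.QuantumLattice.wilsonFlowMatrix r.ρ t U) e i j)
          inferInstance ≤ (inferInstance : MeasurableSpace (GaugeConfig 4 L G)) :=
  fun r b L T _ t => (measurable_flowDecimate r b L T t).comap_le

end Summit.QuantumFields.YangMills.Theorems.FemtoCurvatureTwoPointC

end
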